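import Literature.NumberTheory.EllipticCurves.EisensteinSeriesWeightTwoCharacter
import Literature.NumberTheory.ModularForms.CarayolLemma
import HarnessLib

/-!
# Billerey–Menares 2018, Thm. 2 (⟸) with Thm. 1: the named fact from Carayol's lemma BY NAME

Topic `Literature/NumberTheory/EllipticCurves`; namespace `Literature.NumberTheory.EllipticCurves`.
Proofs only (no new definitions, no new named facts).

The named fact `BillereyMenares2018_exists_newform` (`EisensteinNewformLevelRaising.lean`:
Billerey–Menares 2018, Thm. 1 and Thm. 2 (⟸), §3.2, with the level refinement of the
introduction and Mazur's `(N, k) = (1, 2)` case) was reduced in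
`EisensteinSeriesWeightTwoCharacter.lean` to the single analytic input `hK` — the Katz–Carayol
cuspidal lift of a mod-`p` cuspidal modular form with prescribed nebentypus — by the theorem
`BillereyMenares2018_exists_newform_of_cuspidalLift (hK : …)`, every other step of the printed
proof (generalized Bernoulli numbers, the Eisenstein series `E_k^{𝟙,χ}` and their constant terms at
all cusps, the level-raised form `F₂ = E − E(M·)`, the Galois/Dirichlet dictionary, the
Deligne–Serre lift, newform extraction at level `N ∣ N' ∣ NM`, the weight-`2` series `E_2^{𝟙,χ}`
and Mazur's corner input `E₂(z) − M E₂(Mz)`) being theorems of the tree.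

That input is now the named fact `Literature.NumberTheory.ModularForms.Carayol1989_cuspForm_lift`
(`ModularForms/CarayolLemma.lean`; Carayol 1989 §4.4, Edixhoven 1997 Lemma 1.9 and Prop. 1.10,
Katz 1973 §1.6–1.8), whose body is VERBATIM the binder `hK`. This file records the reduction BY
NAME, so that the dependency is an edge of the tree:

* `BillereyMenares2018_exists_newform_of_carayol1989` —
  `Carayol1989_cuspForm_lift → BillereyMenares2018_exists_newform`.

Consequently the discharge of the fact is the one-liner
`theorem BillereyMenares2018_exists_newform_holds : BillereyMenares2018_exists_newform :=
BillereyMenares2018_exists_newform_of_carayol1989 Carayol1989_cuspForm_lift_holds`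
as soon as `Carayol1989_cuspForm_lift_holds` exists (it belongs in this file).

## References

* N. Billerey, R. Menares, *Strong modularity of reducible Galois representations*, Trans. Amer.
  Math. Soc. 370 (2018), 967–986, Thm. 1, Thm. 2, §3.2 (arXiv:1604.01173). [BillereyMenares2018]
* H. Carayol, *Sur les représentations galoisiennes modulo `ℓ` attachées aux formes modulaires*,
  Duke Math. J. 59 (1989), 785–801, §4.4. [Carayol1989]
* B. Edixhoven, *Serre's conjecture*, in: Modular Forms and Fermat's Last Theorem (Cornell,
  Silverman, Stevens eds.), Springer (1997), 209–242, Lemma 1.9 and Prop. 1.10. [Edixhoven1997]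
-/

namespace Literature.NumberTheory.EllipticCurves

open Literature.NumberTheory.ModularForms

/-- **Billerey–Menares 2018, Thm. 2 (⟸) with Thm. 1, from Carayol's lemma by name**: the named
fact `BillereyMenares2018_exists_newform` follows from the Katz–Carayol cuspidal lift
`Carayol1989_cuspForm_lift` (the only input of the printed proof, §3.2, that is not a theorem of
the tree). The body of `Carayol1989_cuspForm_lift` is verbatim the hypothesis `hK` of
`BillereyMenares2018_exists_newform_of_cuspidalLift`.
[cite: BillereyMenares2018, Thm. 1, Thm. 2, §3.2] [cite: Carayol1989, §4.4]
[cite: Edixhoven1997, Lemma 1.9 and Prop. 1.10] -/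
theorem BillereyMenares2018_exists_newform_of_carayol1989 (h : Carayol1989_cuspForm_lift) :
    BillereyMenares2018_exists_newform :=
  BillereyMenares2018_exists_newform_of_cuspidalLift h

end Literature.NumberTheory.EllipticCurves
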